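import Summits.QuantumFields.YangMills.Theorems.IR.SCFloorSliceTerms
import Summits.QuantumFields.YangMills.Theorems.SoloBlindLatticeGapEndpoints
import Summits.QuantumFields.YangMills.Theorems.SoloBlindOddTorusCorrelator

/-!
# Strong-coupling floor engine, part 20: the slice-sum species and reflection positivity of the slice sum

Pooled prover `ym-ir-line-bsf-p1` (crux `IR`, stmt-QuantumFields-19354), support for the consumer rung R2 of line
`momentum-pincer` (`NoLightMoversSCTransfer`).  With `P = plaquetteObs ρ 0 1 2` and
`s_S(t) = Σ_{x⃗} Corr_{2S+1}(P∘θ_{(0,x̃)}, P; t)` (the plaquette `sliceSumCorr`, written out):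
* `exists_sliceSpecies` — the slice average `F_S = Σ_{x⃗ ∈ (ℤ/(2S+1))³} P∘θ_{(0,x̃)}` is a `YMSpecies` supported on
  time-zero spatial links;
* `latticeConnectedCorr_pair_shift`, `latticeConnectedCorr_shift_congr` — torus translation invariance of the
  connected correlator, and dependence on the shift only modulo the period;
* `latticeConnectedCorr_sliceSpecies` — `Corr_{2S+1}(F_S, F_S; t) = (2S+1)³ · s_S(t)`;
* hence (`sliceSum_nonneg`, `sliceSum_logConvex`) `s_S ≥ 0` and `s_S(n+1)² ≤ s_S(n) s_S(n+2)` for `n + 2 ≤ 2S+1` —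
  by the tree's reflection-positivity results for species (`SoloBlind.latticeConnectedCorr_self_nonneg`,
  `SoloBlind.latticeConnectedCorr_self_logConvex`).
HONEST: strong coupling is not even used here; nothing in this file bears on the Yang–Mills mass gap.
-/

set_option autoImplicit false

noncomputable section

open MeasureTheory Filter Topology Function Finset
open Literature.MathematicalPhysics.QuantumFieldTheory
open Literature.MathematicalPhysics.QuantumLattice (plaquetteObs torusLift toTorusObservable configShift configShift_apply
  LGConfig IsCylinder)
open Literature.Probability.LatticeModels (Torus.proj Torus.proj_apply)

namespace Summit.QuantumFields.YangMills.Cruxes.IR.SCFloor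

variable {G : Type} [Group G] [TopologicalSpace G] [IsTopologicalGroup G] [CompactSpace G] [MeasurableSpace G]
  [BorelSpace G] {N : ℕ} (ρ : G →* Matrix (Fin N) (Fin N) ℂ)

/-! ## §1 The slice-sum species -/

/-- **The slice average of the plaquette is a species on time-zero spatial links.**  For every `S` there is a
`YMSpecies` whose observable is `U ↦ Σ_{x⃗ ∈ (ℤ/(2S+1))³} P(θ_{(0,x̃)} U)` and whose support consists of bonds `(x, i)`
with `x 0 = 0`, `i ≠ 0`. -/
theorem exists_sliceSpecies (hρ : Continuous ρ) (S : ℕ) :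
    ∃ A : YMSpecies G,
      (A.F = fun U => ∑ xs : Fin 3 → ZMod (2 * S + 1),
        plaquetteObs ρ (0 : Literature.Probability.LatticeModels.Site 4) 1 2
          (configShift (fun i : Fin 4 => if h : i = 0 then (0 : ℤ) else ((xs (i.pred h)).valMinAbs : ℤ)) U)) ∧
      ∀ e ∈ A.supp, e.1 0 = 0 ∧ e.2 ≠ 0 := by
  classical
  obtain ⟨Ctr, hCtr0, hCtr⟩ := exists_bound_trace_re_nonneg (ρ := ρ) hρ
  have h12d : ((1 : Fin 4), (2 : Fin 4)).1 < ((1 : Fin 4), (2 : Fin 4)).2 := by decide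
  -- the shifted plaquette observables and their supports
  set v : (Fin 3 → ZMod (2 * S + 1)) → Literature.Probability.LatticeModels.Site 4 :=
    fun xs i => if h : i = 0 then (0 : ℤ) else ((xs (i.pred h)).valMinAbs : ℤ) with hv
  set pl : (Fin 3 → ZMod (2 * S + 1)) → Literature.MathematicalPhysics.QuantumLattice.ZdPlaquette 4 :=
    fun xs => (-(v xs), ⟨((1 : Fin 4), (2 : Fin 4)), h12d⟩) with hpl
  refine ⟨{ F := fun U => ∑ xs : Fin 3 → ZMod (2 * S + 1), plaquetteObs ρ (-(v xs)) 1 2 U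
            supp := Finset.univ.biUnion fun xs => Literature.MathematicalPhysics.QuantumLattice.plaquetteEdges (pl xs)
            isCylinder := ?_, gaugeInvariant := ?_, bounded := ?_, measurable := ?_ }, ?_, ?_⟩
  · intro U V h
    refine Finset.sum_congr rfl fun xs _ => ?_
    exact Literature.MathematicalPhysics.QuantumLattice.isCylinder_plaquetteObs (G := G) ρ (pl xs)
      (fun e he => h e (Finset.mem_biUnion.2 ⟨xs, Finset.mem_univ _, he⟩))
  · intro g U
    exact Finset.sum_congr rfl fun xs _ =>
      Literature.MathematicalPhysics.QuantumLattice.isZdGaugeInvariant_plaquetteObs ρ _ 1 2 g U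
  · refine ⟨(Fintype.card (Fin 3 → ZMod (2 * S + 1)) : ℝ) * Ctr, fun U => ?_⟩
    refine (Finset.abs_sum_le_sum_abs _ _).trans ?_
    calc ∑ xs : Fin 3 → ZMod (2 * S + 1), |plaquetteObs ρ (-(v xs)) 1 2 U|
        ≤ ∑ _xs : Fin 3 → ZMod (2 * S + 1), Ctr := Finset.sum_le_sum fun xs _ => hCtr _
      _ = (Fintype.card (Fin 3 → ZMod (2 * S + 1)) : ℝ) * Ctr := by
          rw [Finset.sum_const, nsmul_eq_mul, Finset.card_univ]
  · exact Finset.measurable_sum _ fun xs _ => measurable_trace_re_plaquette ρ hρ _ 1 2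
  · funext U
    refine Finset.sum_congr rfl fun xs _ => ?_
    rw [Literature.Barriers.QuantumFields.plaquetteObs_configShift, zero_sub]
  · intro e he
    simp only [Finset.mem_biUnion, Finset.mem_univ, true_and] at he
    obtain ⟨xs, he⟩ := he
    have hv0 : (v xs) 0 = 0 := by simp [hv]
    simp only [hpl, Literature.MathematicalPhysics.QuantumLattice.plaquetteEdges, Finset.mem_insert,
      Finset.mem_singleton] at he
    rcases he with rfl | rfl | rfl | rfl <;> simp [hv0]

/-- **The plaquette is a species**: some `YMSpecies` has observable `plaquetteObs ρ 0 1 2`. -/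
theorem exists_plaquetteSpecies (hρ : Continuous ρ) :
    ∃ A : YMSpecies G, A.F = plaquetteObs ρ (0 : Literature.Probability.LatticeModels.Site 4) 1 2 := by
  obtain ⟨Ctr, -, hCtr⟩ := exists_bound_trace_re_nonneg (ρ := ρ) hρ
  have h12d : ((1 : Fin 4), (2 : Fin 4)).1 < ((1 : Fin 4), (2 : Fin 4)).2 := by decide
  exact ⟨{ F := plaquetteObs ρ (0 : Literature.Probability.LatticeModels.Site 4) 1 2
           supp := Literature.MathematicalPhysics.QuantumLattice.plaquetteEdges
             ((0 : Literature.Probability.LatticeModels.Site 4), ⟨((1 : Fin 4), (2 : Fin 4)), h12d⟩)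
           isCylinder := Literature.MathematicalPhysics.QuantumLattice.isCylinder_plaquetteObs (G := G) ρ _
           gaugeInvariant := Literature.MathematicalPhysics.QuantumLattice.isZdGaugeInvariant_plaquetteObs ρ _ 1 2
           bounded := ⟨Ctr, fun U => hCtr _⟩
           measurable := measurable_trace_re_plaquette ρ hρ _ 1 2 }, rfl⟩

/-! ## §2 Translation invariance of the connected correlator -/

/-- **Pair translation invariance**: `Corr_L(A∘θ_b, B∘θ_b; t) = Corr_L(A, B; t)`. -/
theorem latticeConnectedCorr_pair_shift (L : ℕ) [NeZero L] (β : ℝ) (A B : LGConfig 4 G → ℝ)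
    (b : Literature.Probability.LatticeModels.Site 4) (t : ℕ) :
    latticeConnectedCorr ρ β L (fun U => A (configShift b U)) (fun U => B (configShift b U)) t =
      latticeConnectedCorr ρ β L A B t := by
  rw [Summit.QuantumFields.YangMills.Theorems.SoloBlind.latticeConnectedCorr_eq_wilsonExpectation,
    Summit.QuantumFields.YangMills.Theorems.SoloBlind.latticeConnectedCorr_eq_wilsonExpectation]
  have h1 : (fun U => A (configShift b U) * B (configShift b (configShift (-Pi.single 0 (t : ℤ)) U))) =
      (fun U => A U * B (configShift (-Pi.single 0 (t : ℤ)) U)) ∘ configShift b := by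
    funext U
    have hc : configShift b (configShift (-Pi.single 0 (t : ℤ)) U) = configShift (-Pi.single 0 (t : ℤ)) (configShift b U) := by
      funext e; simp only [configShift_apply, sub_sub, add_comm]
    simp only [Function.comp_apply, hc]
  have hA : (fun U => A (configShift b U)) = A ∘ configShift b := rfl
  have hB : (fun U => B (configShift b U)) = B ∘ configShift b := rfl
  rw [h1, hA, hB, wilsonExpectation_toTorusObservable_configShift, wilsonExpectation_toTorusObservable_configShift,
    wilsonExpectation_toTorusObservable_configShift]

/-- **The correlator sees a shift only modulo the period**: if `proj_L u = proj_L u'` then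
`Corr_L(F∘θ_u, B; t) = Corr_L(F∘θ_{u'}, B; t)`. -/
theorem latticeConnectedCorr_shift_congr (L : ℕ) [NeZero L] (β : ℝ) (F B : LGConfig 4 G → ℝ)
    {u u' : Literature.Probability.LatticeModels.Site 4} (h : Torus.proj L u = Torus.proj L u') (t : ℕ) :
    latticeConnectedCorr ρ β L (fun U => F (configShift u U)) B t =
      latticeConnectedCorr ρ β L (fun U => F (configShift u' U)) B t := by
  have key : ∀ U : GaugeConfig 4 L G, F (configShift u (torusLift L U)) = F (configShift u' (torusLift L U)) := by
    intro U
    have h1 := congrFun (toTorusObservable_comp_configShift (G := G) L u F) U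
    have h2 := congrFun (toTorusObservable_comp_configShift (G := G) L u' F) U
    simp only [toTorusObservable, Function.comp_apply] at h1 h2
    rw [h1, h2, h]
  simp only [latticeConnectedCorr, key]

/-! ## §3 The self-correlator of the slice species is `(2S+1)³` times the slice sum -/

/-- **Bilinearity** of the connected correlator over finite sums of bounded measurable observables. -/
theorem latticeConnectedCorr_sum_sum (hρ : Continuous ρ) (L : ℕ) [NeZero L] (β : ℝ) {ι : Type} [Fintype ι]
    (A B : ι → LGConfig 4 G → ℝ) (hAm : ∀ a, Measurable (A a)) (hBm : ∀ a, Measurable (B a))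
    (hAb : ∀ a, ∃ C, ∀ U, |A a U| ≤ C) (hBb : ∀ a, ∃ C, ∀ U, |B a U| ≤ C) (t : ℕ) :
    latticeConnectedCorr ρ β L (fun U => ∑ a, A a U) (fun U => ∑ a, B a U) t =
      ∑ a, ∑ b, latticeConnectedCorr ρ β L (A a) (B b) t := by
  classical
  haveI := isProbabilityMeasure_wilsonMeasure (d := 4) (L := L) ρ hρ β
  set μ := wilsonMeasure (d := 4) (L := L) ρ β with hμ
  have hI : ∀ {F : GaugeConfig 4 L G → ℝ} {C : ℝ}, Measurable F → (∀ U, |F U| ≤ C) → Integrable F μ := fun hF hb =>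
    Integrable.of_bound hF.aestronglyMeasurable _ (Eventually.of_forall fun U => by rw [Real.norm_eq_abs]; exact hb U)
  have hAi : ∀ a, Integrable (fun U : GaugeConfig 4 L G => A a (torusLift L U)) μ := fun a => by
    obtain ⟨C, hC⟩ := hAb a
    exact hI ((hAm a).comp (measurable_torusLift L)) fun U => hC _
  have hBi : ∀ b, Integrable (fun U : GaugeConfig 4 L G => B b (configShift (-Pi.single 0 (t : ℤ)) (torusLift L U))) μ :=
    fun b => by
    obtain ⟨C, hC⟩ := hBb b
    exact hI (((hBm b).comp (configShift _).measurable).comp (measurable_torusLift L)) fun U => hC _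
  have hB0i : ∀ b, Integrable (fun U : GaugeConfig 4 L G => B b (torusLift L U)) μ := fun b => by
    obtain ⟨C, hC⟩ := hBb b
    exact hI ((hBm b).comp (measurable_torusLift L)) fun U => hC _
  have hABi : ∀ a b, Integrable (fun U : GaugeConfig 4 L G =>
      A a (torusLift L U) * B b (configShift (-Pi.single 0 (t : ℤ)) (torusLift L U))) μ := fun a b => by
    obtain ⟨CA, hCA⟩ := hAb a
    obtain ⟨CB, hCB⟩ := hBb b
    have hCA0 : 0 ≤ CA := (abs_nonneg _).trans (hCA fun _ => 1)
    exact hI (((hAm a).comp (measurable_torusLift L)).mul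
      (((hBm b).comp (configShift _).measurable).comp (measurable_torusLift L))) fun U => by
        rw [abs_mul]; exact mul_le_mul (hCA _) (hCB _) (abs_nonneg _) hCA0
  simp only [latticeConnectedCorr]
  rw [← hμ]
  have e1 : ∫ U, (∑ a, A a (torusLift L U)) * ∑ b, B b (configShift (-Pi.single 0 (t : ℤ)) (torusLift L U)) ∂μ =
      ∑ a, ∑ b, ∫ U, A a (torusLift L U) * B b (configShift (-Pi.single 0 (t : ℤ)) (torusLift L U)) ∂μ := by
    simp_rw [Finset.sum_mul_sum]
    rw [integral_finsetSum _ fun a _ => integrable_finsetSum _ fun b _ => hABi a b]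
    exact Finset.sum_congr rfl fun a _ => integral_finsetSum _ fun b _ => hABi a b
  have e2 : ∫ U, ∑ a, A a (torusLift L U) ∂μ = ∑ a, ∫ U, A a (torusLift L U) ∂μ :=
    integral_finsetSum _ fun a _ => hAi a
  have e3 : ∫ U, ∑ b, B b (torusLift L U) ∂μ = ∑ b, ∫ U, B b (torusLift L U) ∂μ :=
    integral_finsetSum _ fun b _ => hB0i b
  rw [e1, e2, e3, Finset.sum_mul_sum, ← Finset.sum_sub_distrib]
  exact Finset.sum_congr rfl fun a _ => by rw [← Finset.sum_sub_distrib]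

/-- **`Corr(F_S, F_S; t) = (2S+1)³ · s_S(t)`**: the self-correlator of the slice species is the slice sum times the
slice volume (torus translation invariance). -/
theorem latticeConnectedCorr_sliceSpecies (hρ : Continuous ρ) (S : ℕ) (β : ℝ) (t : ℕ) :
    latticeConnectedCorr ρ β (2 * S + 1)
        (fun U => ∑ xs : Fin 3 → ZMod (2 * S + 1),
          plaquetteObs ρ (0 : Literature.Probability.LatticeModels.Site 4) 1 2
            (configShift (fun i : Fin 4 => if h : i = 0 then (0 : ℤ) else ((xs (i.pred h)).valMinAbs : ℤ)) U))
        (fun U => ∑ xs : Fin 3 → ZMod (2 * S + 1),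
          plaquetteObs ρ (0 : Literature.Probability.LatticeModels.Site 4) 1 2
            (configShift (fun i : Fin 4 => if h : i = 0 then (0 : ℤ) else ((xs (i.pred h)).valMinAbs : ℤ)) U)) t =
      (Fintype.card (Fin 3 → ZMod (2 * S + 1)) : ℝ) *
        ∑ xs : Fin 3 → ZMod (2 * S + 1), latticeConnectedCorr ρ β (2 * S + 1)
          (fun U => plaquetteObs ρ (0 : Literature.Probability.LatticeModels.Site 4) 1 2
            (configShift (fun i : Fin 4 => if h : i = 0 then (0 : ℤ) else ((xs (i.pred h)).valMinAbs : ℤ)) U))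
          (plaquetteObs ρ (0 : Literature.Probability.LatticeModels.Site 4) 1 2) t := by
  classical
  obtain ⟨Ctr, -, hCtr⟩ := exists_bound_trace_re_nonneg (ρ := ρ) hρ
  set v : (Fin 3 → ZMod (2 * S + 1)) → Literature.Probability.LatticeModels.Site 4 :=
    fun xs i => if h : i = 0 then (0 : ℤ) else ((xs (i.pred h)).valMinAbs : ℤ) with hv
  set P : LGConfig 4 G → ℝ := plaquetteObs ρ (0 : Literature.Probability.LatticeModels.Site 4) 1 2 with hP
  have hPm : Measurable P := measurable_trace_re_plaquette ρ hρ _ 1 2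
  -- bilinearity
  have hbil := latticeConnectedCorr_sum_sum ρ hρ (2 * S + 1) β
    (fun xs U => P (configShift (v xs) U)) (fun xs U => P (configShift (v xs) U))
    (fun xs => hPm.comp (configShift _).measurable) (fun xs => hPm.comp (configShift _).measurable)
    (fun xs => ⟨Ctr, fun U => hCtr _⟩) (fun xs => ⟨Ctr, fun U => hCtr _⟩) t
  change latticeConnectedCorr ρ β (2 * S + 1) (fun U => ∑ xs, P (configShift (v xs) U))
      (fun U => ∑ xs, P (configShift (v xs) U)) t =
    (Fintype.card (Fin 3 → ZMod (2 * S + 1)) : ℝ) * ∑ xs, latticeConnectedCorr ρ β (2 * S + 1)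
      (fun U => P (configShift (v xs) U)) P t
  rw [hbil]
  -- each pair term depends only on the difference
  have hpair : ∀ a b : Fin 3 → ZMod (2 * S + 1),
      latticeConnectedCorr ρ β (2 * S + 1) (fun U => P (configShift (v a) U)) (fun U => P (configShift (v b) U)) t =
        latticeConnectedCorr ρ β (2 * S + 1) (fun U => P (configShift (v (a - b)) U)) P t := by
    intro a b
    -- shift the pair by `-v b`
    have h1 := latticeConnectedCorr_pair_shift ρ (2 * S + 1) β (fun U => P (configShift (v a - v b) U)) P (v b) t
    have hc : ∀ U : LGConfig 4 G, configShift (v a - v b) (configShift (v b) U) = configShift (v a) U := fun U => by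
      funext e; simp only [configShift_apply, sub_sub, sub_add_cancel]
    simp only [hc] at h1
    rw [h1]
    -- `v a - v b ≡ v (a - b)` modulo the period
    refine latticeConnectedCorr_shift_congr ρ (2 * S + 1) β P P ?_ t
    funext k
    rcases Fin.eq_zero_or_eq_succ k with rfl | ⟨i, rfl⟩
    · simp [hv, Torus.proj_apply]
    · simp [hv, Torus.proj_apply, Fin.succ_ne_zero]
  simp_rw [hpair]
  -- re-index `a ↦ a - b`
  have hre : ∀ b : Fin 3 → ZMod (2 * S + 1),
      ∑ a, latticeConnectedCorr ρ β (2 * S + 1) (fun U => P (configShift (v (a - b)) U)) P t =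
        ∑ a, latticeConnectedCorr ρ β (2 * S + 1) (fun U => P (configShift (v a) U)) P t := fun b =>
    Equiv.sum_comp (Equiv.subRight b) (fun a => latticeConnectedCorr ρ β (2 * S + 1) (fun U => P (configShift (v a) U)) P t)
  rw [Finset.sum_comm]
  simp_rw [hre]
  rw [Finset.sum_const, nsmul_eq_mul, Finset.card_univ]

/-! ## §4 Reflection positivity of the slice sum -/

/-- Scaling out a positive constant from a log-convexity inequality. -/
theorem sq_le_mul_of_scaled {K a b c : ℝ} (hK : 0 < K) (h : (K * b) ^ 2 ≤ K * a * (K * c)) : b ^ 2 ≤ a * c := by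
  have h2 : K ^ 2 * b ^ 2 ≤ K ^ 2 * (a * c) := by
    calc K ^ 2 * b ^ 2 = (K * b) ^ 2 := by ring
      _ ≤ K * a * (K * c) := h
      _ = K ^ 2 * (a * c) := by ring
  exact le_of_mul_le_mul_left h2 (by positivity)

/-- **The plaquette slice sum is non-negative**: `0 ≤ s_S(n)` for `S ≥ 1`, `β ≥ 0`. -/
theorem sliceSum_nonneg (hρ : Continuous ρ) {β : ℝ} (hβ : 0 ≤ β) {S : ℕ} (hS : 1 ≤ S) (n : ℕ) :
    0 ≤ ∑ xs : Fin 3 → ZMod (2 * S + 1), latticeConnectedCorr ρ β (2 * S + 1)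
          (fun U => plaquetteObs ρ (0 : Literature.Probability.LatticeModels.Site 4) 1 2
            (configShift (fun i : Fin 4 => if h : i = 0 then (0 : ℤ) else ((xs (i.pred h)).valMinAbs : ℤ)) U))
          (plaquetteObs ρ (0 : Literature.Probability.LatticeModels.Site 4) 1 2) n := by
  obtain ⟨A, hAF, hA⟩ := exists_sliceSpecies ρ hρ S
  have h := Summit.QuantumFields.YangMills.Theorems.SoloBlind.latticeConnectedCorr_self_nonneg ρ hρ hβ hS A hA n
  rw [hAF, latticeConnectedCorr_sliceSpecies ρ hρ] at h
  have hcard : (0 : ℝ) < (Fintype.card (Fin 3 → ZMod (2 * S + 1)) : ℝ) := by exact_mod_cast Fintype.card_pos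
  exact (mul_nonneg_iff_of_pos_left hcard).1 h

/-- **The plaquette slice sum is multiplicatively convex**: `s_S(n+1)² ≤ s_S(n) s_S(n+2)` for `n + 2 ≤ 2S+1`
(`S ≥ 1`, `β ≥ 0`). -/
theorem sliceSum_logConvex (hρ : Continuous ρ) {β : ℝ} (hβ : 0 ≤ β) {S : ℕ} (hS : 1 ≤ S) (n : ℕ)
    (hn : n + 2 ≤ 2 * S + 1) :
    (∑ xs : Fin 3 → ZMod (2 * S + 1), latticeConnectedCorr ρ β (2 * S + 1)
          (fun U => plaquetteObs ρ (0 : Literature.Probability.LatticeModels.Site 4) 1 2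
            (configShift (fun i : Fin 4 => if h : i = 0 then (0 : ℤ) else ((xs (i.pred h)).valMinAbs : ℤ)) U))
          (plaquetteObs ρ (0 : Literature.Probability.LatticeModels.Site 4) 1 2) (n + 1)) ^ 2 ≤
      (∑ xs : Fin 3 → ZMod (2 * S + 1), latticeConnectedCorr ρ β (2 * S + 1)
          (fun U => plaquetteObs ρ (0 : Literature.Probability.LatticeModels.Site 4) 1 2
            (configShift (fun i : Fin 4 => if h : i = 0 then (0 : ℤ) else ((xs (i.pred h)).valMinAbs : ℤ)) U))
          (plaquetteObs ρ (0 : Literature.Probability.LatticeModels.Site 4) 1 2) n) *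
      ∑ xs : Fin 3 → ZMod (2 * S + 1), latticeConnectedCorr ρ β (2 * S + 1)
          (fun U => plaquetteObs ρ (0 : Literature.Probability.LatticeModels.Site 4) 1 2
            (configShift (fun i : Fin 4 => if h : i = 0 then (0 : ℤ) else ((xs (i.pred h)).valMinAbs : ℤ)) U))
          (plaquetteObs ρ (0 : Literature.Probability.LatticeModels.Site 4) 1 2) (n + 2) := by
  obtain ⟨A, hAF, hA⟩ := exists_sliceSpecies ρ hρ S
  have h := Summit.QuantumFields.YangMills.Theorems.SoloBlind.latticeConnectedCorr_self_logConvex ρ hρ hβ hS A hA n hn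
  rw [hAF, latticeConnectedCorr_sliceSpecies ρ hρ, latticeConnectedCorr_sliceSpecies ρ hρ,
    latticeConnectedCorr_sliceSpecies ρ hρ] at h
  have hcard : (0 : ℝ) < (Fintype.card (Fin 3 → ZMod (2 * S + 1)) : ℝ) := by exact_mod_cast Fintype.card_pos
  exact sq_le_mul_of_scaled hcard h

end Summit.QuantumFields.YangMills.Cruxes.IR.SCFloor

end
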